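import Mathlib.LinearAlgebra.Matrix.PosDef
import Mathlib.LinearAlgebra.Matrix.Trace
import Mathlib.Algebra.Polynomial.Coeff
import Mathlib.Algebra.Polynomial.BigOperators
import Mathlib.Analysis.Complex.Basic
import Literature.InformationTheory.QuantumCodes.WeightEnumeratorBounds
import Literature.InformationTheory.QuantumCodes.AdditiveMacWilliams
import HarnessLib

/-!
# Quantum MacWilliams identities, the shadow enumerator, and Rains's LP bound (Theorem 10) — proofs

Topic `Literature/InformationTheory/QuantumCodes` (venture QEC, cell `qec`, PARTITION v2 row 06 / D2.6, rung X1).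
THEOREMS ONLY: this file PROVES the named facts `Rains1999_LPBound` and `Rains1999_LPBound_pure` of
`WeightEnumeratorBounds.lean` (E. M. Rains, *Quantum shadow enumerators*, IEEE Trans. Inform. Theory 45 (1999)
2361–2366 = arXiv:quant-ph/9611001 [Rains1999Shadow], Thm. 10), by carrying out §§1–3 of the source at the
operator level over the tree's Pauli-expansion engine (`Literature.Computability.QuantumComplexity.pauliString`,
`pauliCoeff`, trace orthogonality and entrywise completeness, `PauliExpansion.lean` / `PauliParseval.lean`).

Contents (locators are those of [Rains1999Shadow]; «…» quotes the arXiv text, `lit read paper:arxiv-quant-ph_9611001`):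
* §1 Pauli words: the commutation sign `wordSign S T = (−1)^{⟨S,T⟩}` («`(−1)^{⟨E₁,E₂⟩} = E₁E₂E₁E₂`», §1
  p. 2361), the conjugation table `S·T·S = (−1)^{⟨S,T⟩} T`, the transpose `Tᵀ = (−1)^{wt_y(T)} T`
  («`Ē = (−1)^{wt_y(E)} E`», §2 p. 2363), and the **n-qubit Pauli expansion** `Σ_T Tr(T M)·T = 2ⁿ M`.
* §2 the quaternary **Delsarte/Krawtchouk lemma** `Σ_{wt S = j} (−1)^{⟨S,T⟩} = P_j(wt T, n)` with
  `P_j = krawtchouk4` (generating polynomial `(1 − X)^{wt T} (1 + 3X)^{n − wt T}`, whose coefficient extraction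
  `coeff_krawtchouk4Gen` is REUSED from `AdditiveMacWilliams.lean`, qec-type-01), hence the **weight-class
  twirl** `Σ_{wt S = j} S M S = 2^{−n} Σ_T P_j(wt T, n) Tr(T M)·T`.
* §3 the Shor–Laflamme enumerators `A_d(M₁,M₂) = Σ_{wt E = d} Tr(E M₁) Tr(E M₂)`,
  `B_d(M₁,M₂) = Σ_{wt E = d} Tr(E M₁ E M₂)` (§1 p. 2361) and **Theorem 1 (Duality)** in coefficient form
  `B_j = 2^{−n} Σ_r P_j(r,n) A_r` (the coefficient extraction of «`B(x,y) = A((x+3y)/2,(x−y)/2)`»).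
* §4 the conjugate code `Θ(M) = σ_y^{⊗n} Mᵀ σ_y^{⊗n}` (= «`M̃ = σ_y^{⊗n} M̄ σ_y^{⊗n}`» of Thm. 6 for Hermitian
  `M`, where `M̄ = Mᵀ`), `Tr(T Θ(M)) = (−1)^{wt T} Tr(T M)` (Thm. 6: «`M̃ = Σ (−1)^{wt(E)} c_E E`»), the shadow
  enumerator `S_d(M,N) = B_d(M, Ñ)` (Cor. 7) and **Theorem 8** in coefficient form
  `S_j = 2^{−n} Σ_r (−1)^r P_j(r,n) A_r` («`S(x,y) = A((x+3y)/2,(y−x)/2)`»); positivity `S_d(P,P) ≥ 0`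
  for a projection `P` (Thm. 3 + Cor. 7: «the trace of the product of two positive semi-definite Hermitian
  operators … is nonnegative»).
* §5 **Theorem 2 (Bounds)** for the orthogonal projection `P` onto an `((n,K,d))`: `A_0 = K²`, `A_i ≥ 0`,
  `K B_i − A_i = 0` for `i < d` (Knill–Laflamme: `P E P = c_E P`), `K B_i − A_i ≥ 0` for all `i`
  (here by the variance identity `Tr((K·PEP − Tr(PEP)·P)²) = K (K Tr(EPEP) − Tr(EP)²) ≥ 0`), and the
  assembly **Theorem 10**: `Rains1999_LPBound_holds`, `Rains1999_LPBound_pure_holds` (Remark after Thm. 10).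

Normalisation note (ref-2): the source's Thm. 2 as printed has `A_0(P) = K`, `B_0(P) = K²`, which is
inconsistent with its own definitions (`A_0(P,P) = Tr(P)² = K²`, `B_0(P,P) = Tr(P²) = K`) and with Thm. 10
(`A_0 = K²`); we follow the definitions and Thm. 10, as `WeightEnumeratorBounds.lean` does.

Definitions introduced here (real, reusable operator-level vocabulary; column: definition): `letterSign`,
`wordSign`, `letterTSign`, `wordsOfWt`, the two-operator enumerators `slA`/`slB`, the conjugate `shadowOp`, and
the real single-operator enumerators `enumA`/`enumB`/`enumS`. The LP data (`krawtchouk4`, `rainsDual`,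
`rainsShadow`, `RainsLPFeasible(Pure)`, `IsCodeProjection`, `IsPureToWeight`, `pauliWt`) are type-06's, imported,
never restated. All theorems: column proved; no named facts, no `sorry`.

## Mathlib / tree search

Tree: `pauliString`, `pauliCoeff`, `tensorAll(_mul)`, `trace_pauliString_mul_pauliString`,
`sum_pauliString_apply_mul_apply`, `conjTranspose_pauliString`, `pauliString_mul_self`, `Pauli.sign`,
`Pauli.mat_mul_mat_mul_mat` (QuantumComplexity/PauliExpansion, PauliParseval); `pauliWt`, `krawtchouk4`,
`rainsDual`, `rainsShadow`, `RainsLPFeasible(Pure)`, `IsCodeProjection`, `IsPureToWeight`, `Rains1999_LPBound(_pure)`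
(WeightEnumeratorBounds). The binary analogue of §2 is `Coding.sum_signChar_eq_krawtchouk` (DelsarteLPBound.lean);
the symplectic (`SympVec`) form of §2 is `sum_negOnePow_sympInner_eq_krawtchouk4` (AdditiveMacWilliams.lean, CRSS
Thm. 21, qec-type-01) — different carrier (`𝔽₂^{2n}` vs Pauli words acting as operators), bridgeable through
`toPauliString`; its generating-function lemma `coeff_krawtchouk4Gen` is imported, not restated. Mathlib: `Matrix.PosSemidef` (`posSemidef_conjTranspose_mul_self`,
`mul_mul_conjTranspose_same`, `transpose`, `trace_nonneg` under `open scoped ComplexOrder`), `Polynomial.coeff_mul`,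
`Finset.prod_univ_sum`.
-/

noncomputable section

open Finset Matrix Polynomial
open Literature.Computability.QuantumComplexity

namespace Literature.InformationTheory.QuantumCodes

variable {ι : Type*} [Fintype ι] [DecidableEq ι]

/-! ### §1. Pauli words: commutation signs, conjugation, transpose, expansion -/

/-- The local commutation sign of two Pauli letters as an integer: `+1` if `Q = I`, `P = I` or `Q = P`
(the letters commute), `−1` otherwise — the integer form of `Pauli.sign`.
[cite: Rains1999Shadow, §1 p. 2361 («(−1)^{⟨E₁,E₂⟩} = E₁E₂E₁E₂»)] -/
def letterSign (Q P : Pauli) : ℤ :=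
  if Q = Pauli.I ∨ P = Pauli.I ∨ Q = P then 1 else -1

/-- `letterSign` casts to the tree's complex `Pauli.sign`. [cite: Rains1999Shadow, §1 p. 2361 («(−1)^{⟨E₁,E₂⟩} = E₁E₂E₁E₂»)] -/
theorem cast_letterSign (Q P : Pauli) : (letterSign Q P : ℂ) = Pauli.sign Q P := by
  unfold letterSign Pauli.sign
  split_ifs <;> simp

/-- The **commutation sign** `(−1)^{⟨S,T⟩} = ∏_i sign(S_i,T_i)` of two Pauli words (`+1` iff the strings
commute). [cite: Rains1999Shadow, §1 p. 2361 («(−1)^{⟨E₁,E₂⟩} = E₁E₂E₁E₂»)] -/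
def wordSign (S T : ι → Pauli) : ℤ := ∏ i, letterSign (S i) (T i)

omit [DecidableEq ι] in
/-- `wordSign` casts to the product of the complex local signs. [cite: Rains1999Shadow, §1 p. 2361 («(−1)^{⟨E₁,E₂⟩} = E₁E₂E₁E₂»)] -/
theorem cast_wordSign (S T : ι → Pauli) : (wordSign S T : ℂ) = ∏ i, Pauli.sign (S i) (T i) := by
  simp only [wordSign, Int.cast_prod, cast_letterSign]

omit [DecidableEq ι] in
/-- Scalars pull out of `tensorAll` factorwise: `⊗ (cᵢ Aᵢ) = (∏ cᵢ) ⊗ Aᵢ` (plumbing). [folklore] -/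
private theorem tensorAll_smul (c : ι → ℂ) (A : ι → Matrix Bool Bool ℂ) :
    tensorAll (fun i => c i • A i) = (∏ i, c i) • tensorAll A := by
  ext x y
  simp only [tensorAll_apply, Matrix.smul_apply, smul_eq_mul, Finset.prod_mul_distrib]

/-- **Conjugation table of Pauli words**: `S · T · S = (−1)^{⟨S,T⟩} T`.
[cite: Rains1999Shadow, §1 p. 2361 («(−1)^{⟨E₁,E₂⟩} = E₁E₂E₁E₂»)] -/
theorem pauliString_conj (S T : ι → Pauli) :
    pauliString S * pauliString T * pauliString S = (wordSign S T : ℂ) • pauliString T := by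
  rw [pauliString_eq, pauliString_eq, tensorAll_mul, tensorAll_mul, cast_wordSign]
  simp only [Pauli.mat_mul_mat_mul_mat]
  exact tensorAll_smul _ _

omit [DecidableEq ι] in
/-- Transpose of a tensor product of one-qubit matrices (plumbing). [folklore] -/
private theorem transpose_tensorAll (A : ι → Matrix Bool Bool ℂ) :
    (tensorAll A)ᵀ = tensorAll fun i => (A i)ᵀ := by
  ext x y
  simp only [Matrix.transpose_apply, tensorAll_apply]

/-- The transpose sign of a Pauli letter: `σ_yᵀ = −σ_y`, the other three are symmetric.
[cite: Rains1999Shadow, §2 p. 2363 («1̄ = 1, σ̄_x = σ_x, σ̄_y = −σ_y, σ̄_z = σ_z»)] -/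
def letterTSign (Q : Pauli) : ℤ := if Q = Pauli.Y then -1 else 1

/-- `σ_Qᵀ = (±1) σ_Q` with the sign `letterTSign Q`. [cite: Rains1999Shadow, §2 p. 2363] -/
theorem transpose_mat (Q : Pauli) : (Pauli.mat Q)ᵀ = (letterTSign Q : ℂ) • Pauli.mat Q := by
  ext a b
  cases Q <;> cases a <;> cases b <;> simp [letterTSign, Matrix.transpose_apply]

omit [DecidableEq ι] in
/-- **Transpose of a Pauli word**: `Tᵀ = (−1)^{wt_y(T)} T`, `wt_y` = the number of `σ_y` factors (for the
Hermitian Pauli words, transpose = complex conjugate: «`Ē = (−1)^{wt_y(E)} E`»).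
[cite: Rains1999Shadow, §2 p. 2363] -/
theorem transpose_pauliString (T : ι → Pauli) :
    (pauliString T)ᵀ = ((∏ i, letterTSign (T i) : ℤ) : ℂ) • pauliString T := by
  rw [pauliString_eq, transpose_tensorAll]
  simp only [transpose_mat, Int.cast_prod]
  exact tensorAll_smul _ _

/-- **The n-qubit Pauli expansion**: `Σ_T Tr(T M) · T = 2ⁿ M` for every operator `M` on `n` qubits, i.e.
`M = 2^{−n} Σ_{E ∈ ℰ} Tr(E M) E` («Write `M` as a linear combination of elements of `ℰ`: `M = Σ c_E E`»).
[cite: Rains1999Shadow, Thm. 6 p. 2363; KempeEtAl2010 §2 (δ = 2^{−n} Σ_S δ̂(S) S)] -/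
theorem sum_pauliCoeff_smul_pauliString (M : Matrix (ι → Bool) (ι → Bool) ℂ) :
    ∑ T : ι → Pauli, pauliCoeff M T • pauliString T = (2 : ℂ) ^ Fintype.card ι • M := by
  ext x y
  simp only [Matrix.sum_apply, Matrix.smul_apply, smul_eq_mul, pauliCoeff_eq, Matrix.trace,
    Matrix.diag_apply, Matrix.mul_apply, Finset.sum_mul]
  rw [Finset.sum_comm]
  have h : ∀ a : ι → Bool, ∑ T : ι → Pauli, ∑ b, pauliString T a b * M b a * pauliString T x y =
      ∑ b, M b a * ∑ T : ι → Pauli, pauliString T a b * pauliString T x y := by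
    intro a
    rw [Finset.sum_comm]
    refine Finset.sum_congr rfl fun b _ => ?_
    rw [Finset.mul_sum]
    refine Finset.sum_congr rfl fun T _ => ?_
    ring
  simp only [h, sum_pauliString_apply_mul_apply]
  rw [Finset.sum_eq_single y, Finset.sum_eq_single x]
  · rw [if_pos ⟨rfl, rfl⟩, mul_comm]
  · intro b _ hb
    rw [if_neg (fun h => hb h.2), mul_zero]
  · exact fun h => absurd (Finset.mem_univ x) h
  · intro a _ ha
    exact Finset.sum_eq_zero fun b _ => by rw [if_neg (fun h => ha h.1), mul_zero]
  · exact fun h => absurd (Finset.mem_univ y) h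

/-- The Pauli expansion with the normalisation on the other side: `M = 2^{−n} Σ_T Tr(T M) · T`.
[cite: Rains1999Shadow, Thm. 6 p. 2363] -/
theorem eq_inv_smul_sum_pauliCoeff_smul (M : Matrix (ι → Bool) (ι → Bool) ℂ) :
    M = ((2 : ℂ) ^ Fintype.card ι)⁻¹ • ∑ T : ι → Pauli, pauliCoeff M T • pauliString T := by
  rw [sum_pauliCoeff_smul_pauliString, smul_smul, inv_mul_cancel₀ (pow_ne_zero _ two_ne_zero), one_smul]

/-! ### §2. The quaternary Krawtchouk (Delsarte) lemma and the weight-class twirl -/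

/-- The Pauli words of weight exactly `j`. [cite: Rains1999Shadow, §1 p. 2361 («wt(E) = d»)] -/
def wordsOfWt (ι : Type*) [Fintype ι] [DecidableEq ι] (j : ℕ) : Finset (ι → Pauli) :=
  univ.filter fun S => pauliWt S = j

/-- Membership in `wordsOfWt`: the words `E ∈ ℰ` with `wt(E) = d`. [cite: Rains1999Shadow, §1 p. 2361 (the index sets `wt(E) = d` of A_d, B_d)] -/
@[simp] theorem mem_wordsOfWt {j : ℕ} {S : ι → Pauli} : S ∈ wordsOfWt ι j ↔ pauliWt S = j := by
  simp [wordsOfWt]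

omit [DecidableEq ι] in
/-- The weight of a Pauli word is at most the number of qubits (`0 ≤ d ≤ n` in `A(x,y) = Σ_{0≤d≤n} A_d x^{n−d}y^d`).
[cite: Rains1999Shadow, §1 p. 2361 (A(x,y), B(x,y) summed over 0 ≤ d ≤ n)] -/
theorem pauliWt_le (S : ι → Pauli) : pauliWt S ≤ Fintype.card ι :=
  (Finset.card_filter_le _ _).trans (by rw [Finset.card_univ])

omit [DecidableEq ι] in
/-- The number of identity letters: `#{i : S_i = I} = n − wt(S)` («the weight wt(E) of E as the number of the
σ_i not equal to the identity»). [cite: Rains1999Shadow, §1 p. 2361 (definition of wt(E))] -/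
theorem card_filter_eq_I (S : ι → Pauli) : #{i | S i = Pauli.I} = Fintype.card ι - pauliWt S := by
  have h : #{i | S i = Pauli.I} + pauliWt S = Fintype.card ι :=
    (Finset.card_filter_add_card_filter_not _).trans Finset.card_univ
  omega

/-- Regrouping a sum over all Pauli words by weight: `Σ_T g(T) = Σ_{r=0}^{n} Σ_{wt T = r} g(T)` — the passage
from `Σ_{E ∈ ℰ}` to the enumerator coefficients indexed by `0 ≤ d ≤ n`.
[cite: Rains1999Shadow, §1 p. 2361 (A(x,y) = Σ_{0≤d≤n} A_d x^{n−d} y^d)] -/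
theorem sum_eq_sum_range_wordsOfWt {M : Type*} [AddCommMonoid M] (g : (ι → Pauli) → M) :
    ∑ T : ι → Pauli, g T = ∑ r ∈ range (Fintype.card ι + 1), ∑ T ∈ wordsOfWt ι r, g T := by
  rw [← Finset.sum_fiberwise_of_maps_to (s := (univ : Finset (ι → Pauli))) (t := range (Fintype.card ι + 1))
    (g := pauliWt) (fun T _ => Finset.mem_range.2 (Nat.lt_succ_of_le (pauliWt_le T)))]
  rfl

/-- The one-site generating polynomial: `Σ_Q sign(Q,P) X^{[Q ≠ I]}` is `1 + 3X` for `P = I` and `1 − X`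
otherwise (one commuting and two anticommuting non-identity letters). [cite: Rains1999Shadow, Thm. 1 p. 2361 (the substitution (x+3y, x−y))] -/
theorem sum_letterSign_mul (P : Pauli) :
    ∑ Q : Pauli, Polynomial.C (letterSign Q P) * (if Q = Pauli.I then (1 : ℤ[X]) else X) =
      if P = Pauli.I then (1 : ℤ[X]) + Polynomial.C 3 * X else 1 - X := by
  rw [Pauli.sum_univ]
  cases P <;> simp [letterSign] <;> ring

/-- **Delsarte's lemma, quaternary form.** For a Pauli word `T` of weight `w`,
`Σ_{wt S = j} (−1)^{⟨S,T⟩} = P_j(w,n)`: the commutation-sign sum over all words of weight `j` is a quaternary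
Krawtchouk value (via the generating polynomial `∏_i Σ_Q sign(Q,T_i) X^{[Q≠I]} = (1−X)^w (1+3X)^{n−w}`).
[cite: Rains1999Shadow, Thm. 1 p. 2361 and Thm. 10 p. 2364 (P_j(x,n)); MacWilliamsSloane1977 Ch. 5 §3 Problem (14)] -/
theorem sum_wordSign_eq_krawtchouk4 (j : ℕ) (T : ι → Pauli) :
    ∑ S ∈ wordsOfWt ι j, wordSign S T = krawtchouk4 (Fintype.card ι) j (pauliWt T) := by
  classical
  set Pgen : ℤ[X] := ∏ i, ∑ Q : Pauli, Polynomial.C (letterSign Q (T i)) *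
    (if Q = Pauli.I then (1 : ℤ[X]) else X) with hP
  -- (a) expand the product over words
  have hPa : Pgen = ∑ S : ι → Pauli, Polynomial.C (wordSign S T) * X ^ pauliWt S := by
    rw [hP, Finset.prod_univ_sum]
    refine Finset.sum_congr rfl fun S _ => ?_
    rw [Finset.prod_mul_distrib, wordSign, map_prod, Finset.prod_ite, Finset.prod_const_one, one_mul,
      Finset.prod_const]
    rfl
  have hcoeffa : Pgen.coeff j = ∑ S ∈ wordsOfWt ι j, wordSign S T := by
    rw [hPa, finsetSum_coeff, wordsOfWt, Finset.sum_filter]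
    refine Finset.sum_congr rfl fun S _ => ?_
    rw [Polynomial.coeff_C_mul_X_pow]
    split_ifs with h1 h2 h2 <;> simp_all
  -- (b) the product splits according to the letters of `T`
  have hPb : Pgen = ((1 : ℤ[X]) - X) ^ pauliWt T *
      ((1 : ℤ[X]) + Polynomial.C 3 * X) ^ (Fintype.card ι - pauliWt T) := by
    have hstep : Pgen = ∏ i, (if T i = Pauli.I then (1 : ℤ[X]) + Polynomial.C 3 * X else 1 - X) := by
      rw [hP]
      exact Finset.prod_congr rfl fun i _ => sum_letterSign_mul (T i)
    rw [hstep, Finset.prod_ite, Finset.prod_const, Finset.prod_const, mul_comm, card_filter_eq_I]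
    rfl
  rw [← hcoeffa, hPb, coeff_krawtchouk4Gen]

/-- **Twirl of a Pauli word over a weight class**: `Σ_{wt S = j} S T S = P_j(wt T, n) · T`.
[cite: Rains1999Shadow, Thm. 1 p. 2361 (Duality)] -/
theorem sum_wordsOfWt_conj_pauliString (j : ℕ) (T : ι → Pauli) :
    ∑ S ∈ wordsOfWt ι j, pauliString S * pauliString T * pauliString S =
      (krawtchouk4 (Fintype.card ι) j (pauliWt T) : ℂ) • pauliString T := by
  classical
  simp only [pauliString_conj, ← Finset.sum_smul]
  congr 1
  rw [← sum_wordSign_eq_krawtchouk4 j T, Int.cast_sum]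

/-- **Twirl of an operator over a weight class**, through the Pauli expansion:
`Σ_{wt S = j} S M S = 2^{−n} Σ_T P_j(wt T, n) Tr(T M) · T`. [cite: Rains1999Shadow, Thm. 1 p. 2361 (Duality)] -/
theorem sum_wordsOfWt_conj (j : ℕ) (M : Matrix (ι → Bool) (ι → Bool) ℂ) :
    ∑ S ∈ wordsOfWt ι j, pauliString S * M * pauliString S =
      ((2 : ℂ) ^ Fintype.card ι)⁻¹ •
        ∑ T : ι → Pauli, ((krawtchouk4 (Fintype.card ι) j (pauliWt T) : ℂ) * pauliCoeff M T) • pauliString T := by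
  classical
  conv_lhs => rw [eq_inv_smul_sum_pauliCoeff_smul M]
  simp only [Matrix.mul_smul, Matrix.smul_mul, Finset.mul_sum, Finset.sum_mul, ← Finset.smul_sum]
  congr 1
  rw [Finset.sum_comm]
  refine Finset.sum_congr rfl fun T _ => ?_
  rw [← Finset.smul_sum, sum_wordsOfWt_conj_pauliString, smul_smul, mul_comm]

/-! ### §3. The Shor–Laflamme enumerators and the quantum MacWilliams identity (Theorem 1) -/

/-- The Shor–Laflamme **`A`-enumerator** of a pair of operators: `A_d(M₁,M₂) = Σ_{wt E = d} Tr(E M₁) Tr(E M₂)`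
(Rains's normalisation). [cite: Rains1999Shadow, §1 p. 2361 (definition of A_d(M₁,M₂))] -/
def slA (M₁ M₂ : Matrix (ι → Bool) (ι → Bool) ℂ) (d : ℕ) : ℂ :=
  ∑ E ∈ wordsOfWt ι d, pauliCoeff M₁ E * pauliCoeff M₂ E

/-- The Shor–Laflamme **`B`-enumerator** of a pair of operators: `B_d(M₁,M₂) = Σ_{wt E = d} Tr(E M₁ E M₂)`.
[cite: Rains1999Shadow, §1 p. 2361 (definition of B_d(M₁,M₂))] -/
def slB (M₁ M₂ : Matrix (ι → Bool) (ι → Bool) ℂ) (d : ℕ) : ℂ :=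
  ∑ E ∈ wordsOfWt ι d, (pauliString E * M₁ * pauliString E * M₂).trace

/-- `B_j(M₁,M₂)` through the Pauli expansion: `B_j = 2^{−n} Σ_T P_j(wt T, n) Tr(T M₁) Tr(T M₂)`.
[cite: Rains1999Shadow, Thm. 1 p. 2361 (Duality)] -/
theorem slB_eq_sum (j : ℕ) (M₁ M₂ : Matrix (ι → Bool) (ι → Bool) ℂ) :
    slB M₁ M₂ j = ((2 : ℂ) ^ Fintype.card ι)⁻¹ *
      ∑ T : ι → Pauli, (krawtchouk4 (Fintype.card ι) j (pauliWt T) : ℂ) * (pauliCoeff M₁ T * pauliCoeff M₂ T) := by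
  classical
  unfold slB
  rw [← Matrix.trace_sum, ← Finset.sum_mul, sum_wordsOfWt_conj, Matrix.smul_mul, Matrix.trace_smul,
    Finset.sum_mul, Matrix.trace_sum, smul_eq_mul, Finset.mul_sum, Finset.mul_sum]
  refine Finset.sum_congr rfl fun T _ => ?_
  rw [Matrix.smul_mul, Matrix.trace_smul, smul_eq_mul, ← pauliCoeff_eq]
  ring

/-- **Theorem 1 (Duality), coefficient form.** For all operators `M₁, M₂` on `n` qubits and every `j`,
`B_j(M₁,M₂) = 2^{−n} Σ_{r=0}^{n} P_j(r,n) A_r(M₁,M₂)` — the `x^{n−j}y^j`-coefficient of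
«`B(x,y) = A((x+3y)/2, (x−y)/2)`». (No Hermiticity is needed for this identity.)
[cite: Rains1999Shadow, Thm. 1 p. 2361 (Duality); Thm. 10 p. 2364 (third line of the system)] -/
theorem quantumMacWilliams (j : ℕ) (M₁ M₂ : Matrix (ι → Bool) (ι → Bool) ℂ) :
    slB M₁ M₂ j = ((2 : ℂ) ^ Fintype.card ι)⁻¹ *
      ∑ r ∈ range (Fintype.card ι + 1), (krawtchouk4 (Fintype.card ι) j r : ℂ) * slA M₁ M₂ r := by
  rw [slB_eq_sum, sum_eq_sum_range_wordsOfWt]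
  congr 1
  refine Finset.sum_congr rfl fun r _ => ?_
  rw [slA, Finset.mul_sum]
  exact Finset.sum_congr rfl fun T hT => by rw [mem_wordsOfWt.1 hT]

/-! ### §4. The conjugate code and the shadow enumerator (Theorems 6, 8, Corollary 7, Theorem 3) -/

/-- The **conjugate operator** `Θ(M) = σ_y^{⊗n} Mᵀ σ_y^{⊗n}`; for Hermitian `M` (`M̄ = Mᵀ`) this is Rains's
`M̃ = σ_y^{⊗n} M̄ σ_y^{⊗n}` («Thus the fundamental object seems to be `P̃ = σ_y^{⊗n} P̄ σ_y^{⊗n}`»).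
[cite: Rains1999Shadow, §3 p. 2363 and Thm. 6] -/
def shadowOp (M : Matrix (ι → Bool) (ι → Bool) ℂ) : Matrix (ι → Bool) (ι → Bool) ℂ :=
  pauliString (fun _ => Pauli.Y) * Mᵀ * pauliString (fun _ => Pauli.Y)

omit [DecidableEq ι] in
/-- The sign bookkeeping behind Theorem 6: `(−1)^{⟨σ_y^{⊗n},T⟩} (−1)^{wt_y(T)} = (−1)^{wt(T)}`
(«`wt_y(E) ≡ wt(E) + ⟨σ_y^{⊗n}, E⟩ (mod 2)`»). [cite: Rains1999Shadow, §2 p. 2363] -/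
theorem wordSign_constY_mul_prod_letterTSign (T : ι → Pauli) :
    wordSign (fun _ : ι => Pauli.Y) T * ∏ i, letterTSign (T i) = (-1) ^ pauliWt T := by
  rw [wordSign, ← Finset.prod_mul_distrib]
  have h : ∀ i, letterSign Pauli.Y (T i) * letterTSign (T i) = if T i = Pauli.I then 1 else -1 := by
    intro i
    cases T i <;> simp [letterSign, letterTSign]
  simp only [h, Finset.prod_ite, Finset.prod_const_one, one_mul, Finset.prod_const]
  rfl

/-- **Theorem 6 (coefficient form).** `Tr(T · Θ(M)) = (−1)^{wt(T)} Tr(T M)` for every Pauli word `T` and every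
operator `M`: the Pauli coefficients of `M̃` are those of `M` twisted by `(−1)^{wt(E)}`
(«Define `M̃` by `M̃ = Σ_E (−1)^{wt(E)} c_E E`. Then `M̃ = σ_y^{⊗n} M̄ σ_y^{⊗n}`»).
[cite: Rains1999Shadow, Thm. 6 p. 2363] -/
theorem pauliCoeff_shadowOp (M : Matrix (ι → Bool) (ι → Bool) ℂ) (T : ι → Pauli) :
    pauliCoeff (shadowOp M) T = (-1 : ℂ) ^ pauliWt T * pauliCoeff M T := by
  have h1 : pauliCoeff (shadowOp M) T =
      ((pauliString (fun _ => Pauli.Y) * pauliString T * pauliString (fun _ => Pauli.Y)) * Mᵀ).trace := by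
    rw [pauliCoeff_eq, shadowOp, ← Matrix.mul_assoc, ← Matrix.mul_assoc, Matrix.trace_mul_comm,
      ← Matrix.mul_assoc, ← Matrix.mul_assoc]
  rw [h1, pauliString_conj, Matrix.smul_mul, Matrix.trace_smul, ← Matrix.trace_transpose, Matrix.transpose_mul,
    Matrix.transpose_transpose, Matrix.trace_mul_comm, transpose_pauliString, Matrix.smul_mul, Matrix.trace_smul,
    ← pauliCoeff_eq, smul_eq_mul, smul_eq_mul, ← mul_assoc, ← Int.cast_mul, wordSign_constY_mul_prod_letterTSign,
    Int.cast_pow, Int.cast_neg, Int.cast_one]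

/-- `A_r(M₁, Ñ) = (−1)^r A_r(M₁, N)`. [cite: Rains1999Shadow, Thm. 6 p. 2363 and proof of Thm. 8 p. 2364] -/
theorem slA_shadowOp (M₁ M₂ : Matrix (ι → Bool) (ι → Bool) ℂ) (r : ℕ) :
    slA M₁ (shadowOp M₂) r = (-1 : ℂ) ^ r * slA M₁ M₂ r := by
  rw [slA, slA, Finset.mul_sum]
  refine Finset.sum_congr rfl fun T hT => ?_
  rw [pauliCoeff_shadowOp, mem_wordsOfWt.1 hT]
  ring

/-- **Theorem 8 (shadow duality), coefficient form**, for the shadow enumerator `S_d(M,N) = B_d(M,Ñ)` of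
Corollary 7: `S_j(M₁,M₂) = 2^{−n} Σ_{r=0}^{n} (−1)^r P_j(r,n) A_r(M₁,M₂)` — the coefficient form of
«`S(x,y) = A((x+3y)/2, (y−x)/2)`». [cite: Rains1999Shadow, Cor. 7 and Thm. 8 p. 2364; Thm. 10 (sixth line)] -/
theorem shadowMacWilliams (j : ℕ) (M₁ M₂ : Matrix (ι → Bool) (ι → Bool) ℂ) :
    slB M₁ (shadowOp M₂) j = ((2 : ℂ) ^ Fintype.card ι)⁻¹ *
      ∑ r ∈ range (Fintype.card ι + 1), (-1 : ℂ) ^ r * (krawtchouk4 (Fintype.card ι) j r : ℂ) * slA M₁ M₂ r := by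
  rw [quantumMacWilliams]
  congr 1
  refine Finset.sum_congr rfl fun r _ => ?_
  rw [slA_shadowOp]
  ring

open scoped ComplexOrder

/-- `Θ` preserves positive semi-definiteness («`M̃` is similar to `M`; in particular, if `M` is positive
semi-definite, then so is `M̃`»). [cite: Rains1999Shadow, Thm. 6 p. 2363] -/
theorem posSemidef_shadowOp {M : Matrix (ι → Bool) (ι → Bool) ℂ} (hM : M.PosSemidef) :
    (shadowOp M).PosSemidef := by
  have h := hM.transpose.mul_mul_conjTranspose_same (pauliString fun _ : ι => Pauli.Y)
  rwa [conjTranspose_pauliString] at h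

/-- **Theorem 3 / Corollary 7, for a projection.** If `P` is Hermitian and idempotent and `N` is positive
semi-definite, then every term `Tr(E P E N)` of `B_d(P,N)` is nonnegative («Each of these terms is the trace
of the product of two positive semi-definite Hermitian operators, and is thus nonnegative»; here
`E P E = (PE)†(PE)` and `Tr((PE)†(PE)N) = Tr((PE) N (PE)†)`). [cite: Rains1999Shadow, Thm. 3 p. 2362 and Cor. 7 p. 2364] -/
theorem trace_conj_mul_nonneg {P N : Matrix (ι → Bool) (ι → Bool) ℂ} (hP : P.IsHermitian) (hPP : P * P = P)
    (hN : N.PosSemidef) (E : ι → Pauli) :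
    0 ≤ (pauliString E * P * pauliString E * N).trace := by
  have h1 : pauliString E * P * pauliString E = (P * pauliString E)ᴴ * (P * pauliString E) := by
    rw [Matrix.conjTranspose_mul, conjTranspose_pauliString, hP.eq, ← Matrix.mul_assoc (pauliString E * P),
      Matrix.mul_assoc (pauliString E) P P, hPP]
  rw [h1, Matrix.mul_assoc, Matrix.trace_mul_comm]
  exact (hN.mul_mul_conjTranspose_same _).trace_nonneg

/-! ### §5. Theorem 2 (Bounds) for a code projection, and Theorem 10 -/

/-- The Pauli coefficients `Tr(E M)` of a Hermitian operator are real («Since `M` is Hermitian, all of the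
coefficients `c_E` must be real»). [cite: Rains1999Shadow, proof of Thm. 6 p. 2363] -/
theorem star_pauliCoeff_of_isHermitian {M : Matrix (ι → Bool) (ι → Bool) ℂ} (hM : M.IsHermitian)
    (T : ι → Pauli) : star (pauliCoeff M T) = pauliCoeff M T := by
  rw [pauliCoeff_eq, ← Matrix.trace_conjTranspose, Matrix.conjTranspose_mul, conjTranspose_pauliString, hM.eq,
    Matrix.trace_mul_comm]

/-- For a Hermitian operator, `Tr(E M)` equals the real number `Re Tr(E M)` («Since `M` is Hermitian, all of the
coefficients `c_E` must be real»). [cite: Rains1999Shadow, proof of Thm. 6 p. 2363] -/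
theorem pauliCoeff_eq_ofReal_re {M : Matrix (ι → Bool) (ι → Bool) ℂ} (hM : M.IsHermitian) (T : ι → Pauli) :
    pauliCoeff M T = ((pauliCoeff M T).re : ℂ) := by
  have h := star_pauliCoeff_of_isHermitian hM T
  rw [Complex.star_def] at h
  exact (Complex.conj_eq_iff_re.1 h).symm

/-- For a Hermitian operator, `Tr(E M)² = |Tr(E M)|²` (real coefficients), so that `A_d(M,M) = Σ |Tr(EM)|²`.
[cite: Rains1999Shadow, proof of Thm. 6 p. 2363 («all of the coefficients c_E must be real») and §1 (A_d)] -/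
theorem pauliCoeff_mul_self_of_isHermitian {M : Matrix (ι → Bool) (ι → Bool) ℂ} (hM : M.IsHermitian)
    (T : ι → Pauli) : pauliCoeff M T * pauliCoeff M T = ((‖pauliCoeff M T‖ ^ 2 : ℝ) : ℂ) := by
  rw [Complex.ofReal_pow, ← Complex.mul_conj', ← Complex.star_def, star_pauliCoeff_of_isHermitian hM]

/-- The real `A`-enumerator of a single operator: `A_r(P) = Σ_{wt E = r} |Tr(E P)|²` (= `A_r(P,P)` for
Hermitian `P`; «the solution in the proof is `A_i = Σ_{wt E = i} Tr(EP)²`»).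
[cite: Rains1999Shadow, §1 p. 2361 (A_d) and Thm. 10 p. 2364] -/
def enumA (P : Matrix (ι → Bool) (ι → Bool) ℂ) (r : ℕ) : ℝ :=
  ∑ E ∈ wordsOfWt ι r, ‖pauliCoeff P E‖ ^ 2

/-- The real `B`-enumerator of a single operator: `B_r(P) = Re Σ_{wt E = r} Tr(E P E P)`.
[cite: Rains1999Shadow, §1 p. 2361 (B_d)] -/
def enumB (P : Matrix (ι → Bool) (ι → Bool) ℂ) (r : ℕ) : ℝ := (slB P P r).re

/-- The real shadow enumerator of a single operator: `S_r(P) = Re B_r(P, P̃)`.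
[cite: Rains1999Shadow, Cor. 7 p. 2364 (S_d(M,N) = B_d(M,Ñ))] -/
def enumS (P : Matrix (ι → Bool) (ι → Bool) ℂ) (r : ℕ) : ℝ := (slB P (shadowOp P) r).re

/-- For Hermitian `P`, `A_r(P,P)` is the real number `A_r(P)`. [cite: Rains1999Shadow, §1 p. 2361] -/
theorem slA_self_of_isHermitian {P : Matrix (ι → Bool) (ι → Bool) ℂ} (hP : P.IsHermitian) (r : ℕ) :
    slA P P r = (enumA P r : ℂ) := by
  rw [slA, enumA, Complex.ofReal_sum]
  exact Finset.sum_congr rfl fun T _ => pauliCoeff_mul_self_of_isHermitian hP T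

/-- **Theorem 1 for a Hermitian operator, real form**: `B_j(P) = 2^{−n} Σ_r P_j(r,n) A_r(P) = rainsDual n A j`.
[cite: Rains1999Shadow, Thm. 1 p. 2361; Thm. 10 p. 2364 (third line)] -/
theorem enumB_eq_rainsDual {P : Matrix (ι → Bool) (ι → Bool) ℂ} (hP : P.IsHermitian) (j : ℕ) :
    enumB P j = rainsDual (Fintype.card ι) (enumA P) j := by
  have h : slB P P j = (rainsDual (Fintype.card ι) (enumA P) j : ℂ) := by
    rw [quantumMacWilliams, rainsDual]
    simp only [slA_self_of_isHermitian hP]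
    push_cast
    ring
  rw [enumB, h, Complex.ofReal_re]

/-- **Theorem 8 for a Hermitian operator, real form**: `S_j(P) = 2^{−n} Σ_r (−1)^r P_j(r,n) A_r(P) = rainsShadow n A j`.
[cite: Rains1999Shadow, Thm. 8 p. 2364; Thm. 10 p. 2364 (sixth line)] -/
theorem enumS_eq_rainsShadow {P : Matrix (ι → Bool) (ι → Bool) ℂ} (hP : P.IsHermitian) (j : ℕ) :
    enumS P j = rainsShadow (Fintype.card ι) (enumA P) j := by
  have h : slB P (shadowOp P) j = (rainsShadow (Fintype.card ι) (enumA P) j : ℂ) := by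
    rw [shadowMacWilliams, rainsShadow]
    simp only [slA_self_of_isHermitian hP]
    push_cast
    ring
  rw [enumS, h, Complex.ofReal_re]

/-- `A_0(P) = |Tr P|²`: the only word of weight `0` is the identity. [cite: Rains1999Shadow, Thm. 2 / Thm. 10 p. 2364 (A_0 = K²)] -/
theorem enumA_zero (P : Matrix (ι → Bool) (ι → Bool) ℂ) : enumA P 0 = ‖P.trace‖ ^ 2 := by
  have h : wordsOfWt ι 0 = {fun _ => Pauli.I} := by
    ext S
    simp only [mem_wordsOfWt, Finset.mem_singleton, pauliWt, Finset.card_eq_zero, Finset.filter_eq_empty_iff,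
      Finset.mem_univ, true_implies, not_not, funext_iff]
  rw [enumA, h, Finset.sum_singleton, pauliCoeff_const_I]

/-- `A_r(P) ≥ 0`. [cite: Rains1999Shadow, Thm. 2 p. 2361 (A_i(P) ≥ 0)] -/
theorem enumA_nonneg (P : Matrix (ι → Bool) (ι → Bool) ℂ) (r : ℕ) : 0 ≤ enumA P r :=
  Finset.sum_nonneg fun _ _ => by positivity

/-- **Corollary 7 for a code projection**: `S_r(P) ≥ 0` when `P` is Hermitian and idempotent.
[cite: Rains1999Shadow, Cor. 7 p. 2364; Thm. 10 p. 2364 (S_i ≥ 0)] -/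
theorem enumS_nonneg {P : Matrix (ι → Bool) (ι → Bool) ℂ} (hP : P.IsHermitian) (hPP : P * P = P) (r : ℕ) :
    0 ≤ enumS P r := by
  have hpsd : P.PosSemidef := by
    have h := Matrix.posSemidef_conjTranspose_mul_self P
    rwa [hP.eq, hPP] at h
  rw [enumS, slB, Complex.re_sum]
  exact Finset.sum_nonneg fun E _ =>
    (Complex.nonneg_iff.1 (trace_conj_mul_nonneg hP hPP (posSemidef_shadowOp hpsd) E)).1

/-- **Knill–Laflamme ⇒ `K B_E − A_E = 0`.** If `P` is a Hermitian idempotent of trace `K` and `P E P = c P`, then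
`Tr(EP)² = K · Tr(EPEP)` (both equal `c²K²`, resp. `c²K` times `K`).
[cite: Rains1999Shadow, Thm. 2 p. 2361 (K B_i(P) − A_i(P) = 0 for 0 ≤ i < d); KnillLaflamme1997 Thm. 3.2] -/
theorem pauliCoeff_sq_eq_of_detects {P : Matrix (ι → Bool) (ι → Bool) ℂ} (hPP : P * P = P) {K : ℂ}
    (hK : P.trace = K) {E : ι → Pauli} {c : ℂ} (hc : P * pauliString E * P = c • P) :
    pauliCoeff P E * pauliCoeff P E = K * (pauliString E * P * pauliString E * P).trace := by
  have h1 : pauliCoeff P E = c * K := by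
    rw [pauliCoeff_eq, ← hPP, ← Matrix.mul_assoc, Matrix.trace_mul_comm, ← Matrix.mul_assoc, hc,
      Matrix.trace_smul, hK, smul_eq_mul]
  have h2 : (pauliString E * P * pauliString E * P).trace = c * (c * K) := by
    rw [Matrix.mul_assoc, Matrix.mul_assoc, ← Matrix.mul_assoc P, hc, Matrix.mul_smul, Matrix.trace_smul,
      smul_eq_mul, ← pauliCoeff_eq, h1]
  rw [h1, h2]
  ring

/-- **`K B_E − A_E ≥ 0` for every Pauli word.** For a Hermitian idempotent `P` of trace `K`:
`|Tr(EP)|² ≤ K · Re Tr(EPEP)`, from `0 ≤ Tr(M†M)` for `M = K·PEP − Tr(PEP)·P`, which expands to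
`K (K Tr(EPEP) − Tr(EP)²)`. [cite: Rains1999Shadow, Thm. 2 p. 2361 (K B_i(P) − A_i(P) ≥ 0)] -/
theorem norm_pauliCoeff_sq_le {P : Matrix (ι → Bool) (ι → Bool) ℂ} (hP : P.IsHermitian) (hPP : P * P = P)
    {K : ℕ} (hK : P.trace = (K : ℂ)) (E : ι → Pauli) :
    ‖pauliCoeff P E‖ ^ 2 ≤ K * (pauliString E * P * pauliString E * P).trace.re := by
  have hNP : P * pauliString E * P * P = P * pauliString E * P := by rw [Matrix.mul_assoc, hPP]
  have hPN : P * (P * pauliString E * P) = P * pauliString E * P := by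
    rw [← Matrix.mul_assoc, ← Matrix.mul_assoc, hPP]
  have htrN : (P * pauliString E * P).trace = pauliCoeff P E := by
    rw [pauliCoeff_eq, Matrix.trace_mul_comm, ← Matrix.mul_assoc, hPP, Matrix.trace_mul_comm]
  have htrNN : (P * pauliString E * P * (P * pauliString E * P)).trace =
      (pauliString E * P * pauliString E * P).trace := by
    rw [← Matrix.mul_assoc (P * pauliString E * P) (P * pauliString E) P,
      ← Matrix.mul_assoc (P * pauliString E * P) P (pauliString E), Matrix.mul_assoc (P * pauliString E) P P, hPP,
      Matrix.mul_assoc P (pauliString E) P, Matrix.mul_assoc P (pauliString E * P) (pauliString E),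
      Matrix.mul_assoc P (pauliString E * P * pauliString E) P, Matrix.trace_mul_comm,
      Matrix.mul_assoc (pauliString E * P * pauliString E) P P, hPP]
  have hNh : (P * pauliString E * P).IsHermitian := by
    change (P * pauliString E * P)ᴴ = P * pauliString E * P
    rw [Matrix.conjTranspose_mul, Matrix.conjTranspose_mul, conjTranspose_pauliString, hP.eq, Matrix.mul_assoc]
  set N : Matrix (ι → Bool) (ι → Bool) ℂ := P * pauliString E * P with hN
  set M : Matrix (ι → Bool) (ι → Bool) ℂ := (K : ℂ) • N - N.trace • P with hM
  -- `Tr(M† M) ≥ 0`, and `M† = M`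
  have hMh : Mᴴ = M := by
    rw [hM, Matrix.conjTranspose_sub, Matrix.conjTranspose_smul, Matrix.conjTranspose_smul, hNh.eq, hP.eq,
      htrN, star_pauliCoeff_of_isHermitian hP, Complex.star_def, Complex.conj_natCast]
  have hpos : 0 ≤ (M * M).trace := by
    have h := (Matrix.posSemidef_conjTranspose_mul_self M).trace_nonneg
    rwa [hMh] at h
  have hexp : (M * M).trace = (K : ℂ) * ((K : ℂ) * (N * N).trace - N.trace * N.trace) := by
    rw [hM]
    simp only [Matrix.sub_mul, Matrix.mul_sub, Matrix.smul_mul, Matrix.mul_smul, hNP, hPN, hPP, Matrix.trace_sub,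
      Matrix.trace_smul, smul_eq_mul, hK]
    ring
  rw [hexp, htrNN, htrN] at hpos
  -- read off real parts
  rcases Nat.eq_zero_or_pos K with hK0 | hKpos
  · -- `K = 0`: then `P = 0`
    subst hK0
    have hP0 : P = 0 := by
      have h : (Pᴴ * P).trace = 0 := by rw [hP.eq, hPP, hK, Nat.cast_zero]
      exact Matrix.trace_conjTranspose_mul_self_eq_zero_iff.1 h
    simp [pauliCoeff_eq, hP0]
  · have h2 := (Complex.nonneg_iff.1 hpos).1
    rw [Complex.mul_re, Complex.natCast_re, Complex.natCast_im, zero_mul, sub_zero, Complex.sub_re,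
      Complex.mul_re, Complex.natCast_re, Complex.natCast_im, zero_mul, sub_zero,
      pauliCoeff_mul_self_of_isHermitian hP, Complex.ofReal_re] at h2
    have hKr : (0 : ℝ) < K := Nat.cast_pos.2 hKpos
    nlinarith

/-- **Theorem 2 (Bounds) + Theorem 10 for a code projection on an arbitrary finite qubit register**, with the
explicit solution `A_i := A_i(P) = Σ_{wt E = i} |Tr(EP)|²`: if `P` is the orthogonal projection onto an `((n,K,d))`
(`IsCodeProjection P K d`, `n = |ι|`), then `A_0 = K²`, `A_i ≥ 0`, `A_i = K B_i` for `i < d`, `A_i ≤ K B_i` for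
all `i`, and `S_i ≥ 0`, where `B_i = 2^{−n} Σ_r P_i(r,n) A_r` and `S_i = 2^{−n} Σ_r (−1)^r P_i(r,n) A_r`.
[cite: Rains1999Shadow, Thm. 2 p. 2361 and Thm. 10 p. 2364, via Thms. 1, 3, 6, 8 and Cor. 7] -/
theorem enumA_feasible {K d : ℕ} {P : Matrix (ι → Bool) (ι → Bool) ℂ} (hP : IsCodeProjection P K d) :
    enumA P 0 = (K : ℝ) ^ 2 ∧
    (∀ i, 0 ≤ enumA P i) ∧
    (∀ i, i < d → enumA P i = K * rainsDual (Fintype.card ι) (enumA P) i) ∧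
    (∀ i, enumA P i ≤ K * rainsDual (Fintype.card ι) (enumA P) i) ∧
    (∀ i, 0 ≤ rainsShadow (Fintype.card ι) (enumA P) i) := by
  obtain ⟨hH, hPP, htr, hdet⟩ := hP
  refine ⟨?_, enumA_nonneg P, fun i hi => ?_, fun i => ?_, fun i => ?_⟩
  · rw [enumA_zero, htr, Complex.norm_natCast]
  · -- `i < d`: Knill–Laflamme
    rw [← enumB_eq_rainsDual hH, enumB, slB, Complex.re_sum, Finset.mul_sum, enumA]
    refine Finset.sum_congr rfl fun E hE => ?_
    obtain ⟨c, hc⟩ := hdet E (by rw [mem_wordsOfWt.1 hE]; omega)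
    have h := pauliCoeff_sq_eq_of_detects hPP htr hc
    rw [pauliCoeff_mul_self_of_isHermitian hH] at h
    have h' := congrArg Complex.re h
    rw [Complex.ofReal_re, Complex.mul_re, Complex.natCast_re, Complex.natCast_im, zero_mul, sub_zero] at h'
    exact h'
  · -- every `i`: the variance inequality
    rw [← enumB_eq_rainsDual hH, enumB, slB, Complex.re_sum, Finset.mul_sum, enumA]
    exact Finset.sum_le_sum fun E _ => norm_pauliCoeff_sq_le hH hPP htr E
  · rw [← enumS_eq_rainsShadow hH]
    exact enumS_nonneg hH hPP i

/-- **Rains's Theorem 10 on an arbitrary finite qubit register**: a code projection makes Rains's linear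
system feasible. [cite: Rains1999Shadow, Thm. 10 p. 2364 (LP bound for general QECCs)] -/
theorem rainsLPFeasible_of_isCodeProjection {K d : ℕ} {P : Matrix (ι → Bool) (ι → Bool) ℂ}
    (hP : IsCodeProjection P K d) : RainsLPFeasible (Fintype.card ι) K d := by
  obtain ⟨h0, h1, h2, h3, h4⟩ := enumA_feasible hP
  exact ⟨enumA P, h0, fun i _ => h1 i, h2, fun i _ _ => h3 i, fun i _ => h4 i⟩

/-- **Rains's LP bound for general QECCs (Theorem 10) — discharge of the named fact `Rains1999_LPBound`.**
«If a `((n,K,d))` exists, then there is a solution to the following set of linear equations and inequalities: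
`A_0 = K²`; `A_i ≥ 0`; `B_i = 2^{−n} Σ_r P_i(r,n) A_r`; `A_i = K B_i` (`0 ≤ i < d`); `A_i ≤ K B_i` (`d ≤ i ≤ n`);
`S_i = 2^{−n} Σ_r (−1)^r P_i(r,n) A_r`; `S_i ≥ 0`.» Column: proved.
[cite: Rains1999Shadow, Thm. 10 p. 2364] -/
theorem Rains1999_LPBound_holds : Rains1999_LPBound := by
  intro n K d P hP
  have h := rainsLPFeasible_of_isCodeProjection hP
  rwa [Fintype.card_fin] at h

/-- **Rains's LP bound for pure codes — discharge of the named fact `Rains1999_LPBound_pure`.** For a pure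
`((n,K,d))` the same `A_i = Σ_{wt E = i} Tr(EP)²` also satisfy `A_i = 0` for `1 ≤ i < d` («For pure codes, the
additional constraint that `A_i = 0` for `1 ≤ i < d` must hold»). Column: proved.
[cite: Rains1999Shadow, Remark after Thm. 10 p. 2364] -/
theorem Rains1999_LPBound_pure_holds : Rains1999_LPBound_pure := by
  intro n K d P hP hpure
  obtain ⟨h0, h1, h2, h3, h4⟩ := enumA_feasible hP
  rw [Fintype.card_fin] at h2 h3 h4
  refine ⟨enumA P, h0, fun i _ => h1 i, fun i hi1 hid => ?_, h2, fun i _ _ => h3 i, fun i _ => h4 i⟩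
  refine Finset.sum_eq_zero fun E hE => ?_
  rw [mem_wordsOfWt] at hE
  rw [pauliCoeff_eq, hpure E (by omega) (by omega), norm_zero, zero_pow two_ne_zero]

end Literature.InformationTheory.QuantumCodes
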